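import Mathlib.Analysis.SpecialFunctions.Integrals.Basic
import Mathlib.Analysis.SpecialFunctions.ImproperIntegrals
import Mathlib.MeasureTheory.Integral.MeanInequalities
import Mathlib.MeasureTheory.Function.EssSup
import Mathlib.MeasureTheory.Measure.Lebesgue.Integral
import HarnessLib

/-!
# Real-variable lemmas for the Liouville theorem of Seregin (2014, Thm. 4.12): a Volterra
# bootstrap with a weakly singular kernel, and a selection lemma for integrable tails

Analysis/FluidPDE support file (theorems only, no definitions, no named facts) on the discharge
path of the named fact `Literature.Analysis.FluidPDE.Seregin2014_ancient_liouville_LPS`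
(`AncientLPSLiouville.lean`; G. Seregin, *Lecture Notes on Regularity Theory for the
Navier–Stokes Equations*, World Scientific 2014, Ch. 6, §6.4.1, Theorem 4.12: a bounded ancient
solution with a finite Ladyzhenskaya–Prodi–Serrin quantity `∫_{-∞}^0 ‖u(t)‖_{L^s}^l dt < ∞`,
`3/s + 2/l = 1`, `l < ∞`, vanishes). The discharge (`AncientLPSLiouvilleProofs.lean`) runs a
small-data stability argument in `L^s` for the Oseen (mild) form of the equations; this file
isolates its three elementary real-variable ingredients, with the unknown `n(σ) = ‖u(σ)‖_{L^s}`
abstracted into an arbitrary function `n : ℝ → ℝ≥0∞`: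

* `lintegral_Ioo_ofReal_rpow_neg_sub_le` — the kernel integrals
  `∫_{(s,c)} (t - σ)^{-γ} dσ ≤ (t - s)^{1-γ}/(1-γ)` for `γ < 1`, `s ≤ c ≤ t`, in `ℝ≥0∞`;
* `exists_forall_lintegral_rpow_neg_half_mul_le` — the a priori bound: if `∫_{(s,T)} n^l < ∞` with
  `l > 2`, then `∫_{(s,t)} (t-σ)^{-1/2} n(σ) dσ` is bounded uniformly in `t ∈ (s, T]` (Hölder in
  time; `(t - σ)^{-1/2} ∈ L^{l'}` because `l' < 2`);
* `ae_le_four_mul_of_volterra_bootstrap` — **the bootstrap**: if `n` is essentially bounded on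
  `(s, T)` and satisfies, for a.e. `t` and every splitting time `t₁ ∈ [s, t]`, the Volterra
  inequality `n(t) ≤ δ + C₁ ∫_{(s,t₁)} (t-σ)^{-1/2-a} n(σ)² dσ + C₂ ∫_{(t₁,t)} (t-σ)^{-1/2} n(σ) dσ`
  (`a < 1/2`; quadratic "history" term, linear "local" term), and the smallness condition
  `16 C₁ δ (T-s)^{1/2-a}/(1/2-a) ≤ 1` holds, then `n ≤ 4δ` a.e. on `(s, T)` (induction over
  windows of length `τ₀ = (4(C₂+1))⁻²`: on each window the local term is absorbed into the
  essential supremum, the history term is `≤ δ` by smallness);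
* `measure_pos_setOf_mul_lt_of_lintegral_Iio_ne_top` — **selection of good early times**: if
  `∫_{(-∞,0)} F < ∞` then for every `R > 0` and `ε > 0` the set of `σ < -R` with `F(σ)·|σ| < ε`
  has positive measure (otherwise `F(σ) ≥ ε/|σ|` a.e. below `-R`, whose integral diverges).

Everything is proved; nothing here is specific to the Navier–Stokes equations.

## References

* G. Seregin, *Lecture Notes on Regularity Theory for the Navier–Stokes Equations*, World
  Scientific (2014), Ch. 6, §6.4.1, Theorem 4.12 (printed p. 166). [Seregin2014Notes]
* T. Kato, *Strong `L^p`-solutions of the Navier–Stokes equation in `ℝ^m`, with applications to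
  weak solutions*, Math. Z. 187 (1984) 471–480, §2 (the weakly singular Volterra inequalities of
  the `L^p` theory). [Kato1984]
-/

noncomputable section

open MeasureTheory Set Filter
open scoped ENNReal NNReal Topology

namespace Literature.Analysis.FluidPDE

/-! ### Kernel integrals `∫ (t - σ)^{-γ} dσ` -/

section Kernel

/-- `σ ↦ (t - σ)^{-γ}` is interval integrable on every interval when `γ < 1`. [folklore] -/
theorem intervalIntegrable_rpow_neg_sub_left {γ : ℝ} (hγ : γ < 1) (t a b : ℝ) :
    IntervalIntegrable (fun σ : ℝ => (t - σ) ^ (-γ)) volume a b := by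
  have h := (intervalIntegral.intervalIntegrable_rpow' (a := t - a) (b := t - b)
    (by linarith : (-1 : ℝ) < -γ)).comp_sub_left t
  simpa using h

/-- `∫ₛᵗ (t - σ)^{-γ} dσ = (t - s)^{1-γ}/(1-γ)` for `γ < 1`. [folklore] -/
theorem integral_rpow_neg_sub_left {γ : ℝ} (hγ : γ < 1) (s t : ℝ) :
    ∫ σ in s..t, (t - σ) ^ (-γ) = (t - s) ^ (1 - γ) / (1 - γ) := by
  rw [intervalIntegral.integral_comp_sub_left (fun σ => σ ^ (-γ)) t,
    integral_rpow (Or.inl (by linarith : (-1 : ℝ) < -γ)), sub_self,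
    show -γ + 1 = 1 - γ by ring, Real.zero_rpow (by linarith : (1 : ℝ) - γ ≠ 0), sub_zero]

/-- Measurability of the kernel `σ ↦ ofReal ((t - σ)^{-γ})`. [folklore] -/
theorem measurable_ofReal_rpow_sub_left (t γ : ℝ) :
    Measurable fun σ : ℝ => ENNReal.ofReal ((t - σ) ^ (-γ)) :=
  ENNReal.measurable_ofReal.comp ((measurable_const.sub measurable_id).pow_const _)

/-- **The kernel integral in `ℝ≥0∞`**: for `0 ≤ γ < 1` and `s ≤ c ≤ t`,
`∫_{(s,c)} (t - σ)^{-γ} dσ ≤ (t - s)^{1-γ}/(1-γ)` (enlarge `(s,c)` to `(s,t)` and evaluate).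
[folklore] -/
theorem lintegral_Ioo_ofReal_rpow_neg_sub_le {γ : ℝ} (hγ : γ < 1) {s c t : ℝ}
    (hsc : s ≤ c) (hct : c ≤ t) :
    ∫⁻ σ in Ioo s c, ENNReal.ofReal ((t - σ) ^ (-γ)) ≤
      ENNReal.ofReal ((t - s) ^ (1 - γ) / (1 - γ)) := by
  have hst : s ≤ t := hsc.trans hct
  have hint : IntegrableOn (fun σ : ℝ => (t - σ) ^ (-γ)) (Ioo s t) volume := by
    have h := intervalIntegrable_rpow_neg_sub_left hγ t s t
    rw [intervalIntegrable_iff_integrableOn_Ioo_of_le hst] at h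
    exact h
  have hnn : 0 ≤ᵐ[volume.restrict (Ioo s t)] fun σ : ℝ => (t - σ) ^ (-γ) := by
    refine (ae_restrict_iff' measurableSet_Ioo).2 (Eventually.of_forall fun σ hσ => ?_)
    exact Real.rpow_nonneg (by linarith [hσ.2]) _
  calc ∫⁻ σ in Ioo s c, ENNReal.ofReal ((t - σ) ^ (-γ))
      ≤ ∫⁻ σ in Ioo s t, ENNReal.ofReal ((t - σ) ^ (-γ)) :=
        lintegral_mono_set (Ioo_subset_Ioo_right hct)
    _ = ENNReal.ofReal (∫ σ in Ioo s t, (t - σ) ^ (-γ)) :=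
        (ofReal_integral_eq_lintegral_ofReal hint hnn).symm
    _ = ENNReal.ofReal ((t - s) ^ (1 - γ) / (1 - γ)) := by
        rw [← integral_Ioc_eq_integral_Ioo, ← intervalIntegral.integral_of_le hst,
          integral_rpow_neg_sub_left hγ]

end Kernel

/-! ### The a priori bound: Hölder in time -/

section Apriori

/-- **Hölder in time against the kernel `(t-σ)^{-1/2}`**: for `l > 2`, with `q = l/(l-1) < 2`
the conjugate exponent, and `n` a.e.-measurable on `(s, T)`,
`∫_{(s,t)} (t-σ)^{-1/2} n(σ) dσ ≤ ((T-s)^{1-q/2}/(1-q/2))^{1/q} (∫_{(s,T)} n^l)^{1/l}`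
for every `t ∈ (s, T]`. [folklore] -/
theorem lintegral_rpow_neg_half_mul_le_holder {n : ℝ → ℝ≥0∞} {s T : ℝ} {l : ℝ} (hl : 2 < l)
    (hn : AEMeasurable n (volume.restrict (Ioo s T))) {t : ℝ} (ht : t ∈ Ioc s T) :
    ∫⁻ σ in Ioo s t, ENNReal.ofReal ((t - σ) ^ (-(1 / 2 : ℝ))) * n σ ≤
      ENNReal.ofReal ((T - s) ^ (1 - l / (l - 1) / 2) / (1 - l / (l - 1) / 2)) ^ (1 / (l / (l - 1))) *
        (∫⁻ σ in Ioo s T, n σ ^ l) ^ (1 / l) := by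
  set q : ℝ := l / (l - 1) with hq
  have hl1 : 0 < l - 1 := by linarith
  have hq0 : 0 < q := by positivity
  have hq2 : q < 2 := by
    rw [hq, div_lt_iff₀ hl1]; linarith
  have hq1 : 1 < q := by
    rw [hq, lt_div_iff₀ hl1]; linarith
  have hl0 : 0 < l := by linarith
  have hpq : q.HolderConjugate l := by
    refine ⟨?_, hq0, hl0⟩
    rw [hq, inv_one]
    field_simp
    ring
  have hst : s < t := ht.1
  have hsub : Ioo s t ⊆ Ioo s T := Ioo_subset_Ioo_right ht.2
  have hn' : AEMeasurable n (volume.restrict (Ioo s t)) :=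
    hn.mono_measure (Measure.restrict_mono hsub le_rfl)
  have hk : AEMeasurable (fun σ : ℝ => ENNReal.ofReal ((t - σ) ^ (-(1 / 2 : ℝ))))
      (volume.restrict (Ioo s t)) :=
    (measurable_ofReal_rpow_sub_left t (1 / 2)).aemeasurable
  have hH := ENNReal.lintegral_mul_le_Lp_mul_Lq (volume.restrict (Ioo s t)) hpq hk hn'
  refine hH.trans (mul_le_mul' ?_ ?_)
  · -- the kernel factor
    refine ENNReal.rpow_le_rpow ?_ (by positivity)
    have hγ : q / 2 < 1 := by linarith
    calc ∫⁻ σ in Ioo s t, ENNReal.ofReal ((t - σ) ^ (-(1 / 2 : ℝ))) ^ q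
        = ∫⁻ σ in Ioo s t, ENNReal.ofReal ((t - σ) ^ (-(q / 2))) := by
          refine setLIntegral_congr_fun measurableSet_Ioo fun σ hσ => ?_
          have h0 : 0 ≤ t - σ := by linarith [hσ.2]
          rw [ENNReal.ofReal_rpow_of_nonneg (Real.rpow_nonneg h0 _) hq0.le, ← Real.rpow_mul h0]
          congr 2
          ring
      _ ≤ ENNReal.ofReal ((t - s) ^ (1 - q / 2) / (1 - q / 2)) :=
          lintegral_Ioo_ofReal_rpow_neg_sub_le hγ hst.le le_rfl
      _ ≤ ENNReal.ofReal ((T - s) ^ (1 - q / 2) / (1 - q / 2)) := by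
          refine ENNReal.ofReal_le_ofReal (div_le_div_of_nonneg_right ?_ (by linarith))
          exact Real.rpow_le_rpow (by linarith) (by linarith [ht.2]) (by linarith)
  · exact ENNReal.rpow_le_rpow (lintegral_mono_set hsub) (by positivity)

/-- **Uniform a priori bound.** If `l > 2`, `n` is a.e.-measurable on `(s, T)` and
`∫_{(s,T)} n^l < ∞`, then `∫_{(s,t)} (t-σ)^{-1/2} n(σ) dσ ≤ B < ∞` for one `B` and all
`t ∈ (s, T]`. [folklore] -/
theorem exists_forall_lintegral_rpow_neg_half_mul_le {n : ℝ → ℝ≥0∞} {s T : ℝ} {l : ℝ} (hl : 2 < l)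
    (hn : AEMeasurable n (volume.restrict (Ioo s T))) (hL : ∫⁻ σ in Ioo s T, n σ ^ l ≠ ∞) :
    ∃ B : ℝ≥0∞, B ≠ ∞ ∧ ∀ t ∈ Ioc s T,
      ∫⁻ σ in Ioo s t, ENNReal.ofReal ((t - σ) ^ (-(1 / 2 : ℝ))) * n σ ≤ B := by
  refine ⟨_, ?_, fun t ht => lintegral_rpow_neg_half_mul_le_holder hl hn ht⟩
  have hl0 : 0 < l := by linarith
  have hl1 : 0 < l - 1 := by linarith
  have hq0 : 0 < l / (l - 1) := by positivity
  exact ENNReal.mul_ne_top (ENNReal.rpow_ne_top_of_nonneg (one_div_pos.2 hq0).le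
    ENNReal.ofReal_ne_top) (ENNReal.rpow_ne_top_of_nonneg (one_div_pos.2 hl0).le hL)

end Apriori

/-! ### The Volterra bootstrap -/

section Bootstrap

/-- **Absorption in `ℝ≥0∞`**: `Y ≤ A + Y/2` and `Y ≠ ∞` give `Y ≤ 2A`. [folklore] -/
theorem ENNReal.le_two_mul_of_le_add_half {Y A : ℝ≥0∞} (hY : Y ≠ ∞) (h : Y ≤ A + Y / 2) :
    Y ≤ 2 * A := by
  have h2 : Y / 2 ≠ ∞ := ENNReal.div_ne_top hY two_ne_zero
  have h3 : Y / 2 + Y / 2 ≤ A + Y / 2 := by rwa [ENNReal.add_halves]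
  have h4 : Y / 2 ≤ A := (ENNReal.add_le_add_iff_right h2).1 h3
  calc Y = Y / 2 + Y / 2 := (ENNReal.add_halves Y).symm
    _ ≤ A + A := add_le_add h4 h4
    _ = 2 * A := (two_mul A).symm

/-- **The Volterra bootstrap with a weakly singular kernel** (the real-variable core of the
small-data `L^p` stability argument; cf. Kato 1984, §2). Let `n : ℝ → ℝ≥0∞` be essentially
bounded on `(s, T)` and satisfy, for a.e. `t ∈ (s, T)` and every `t₁ ∈ [s, t]`,
`n(t) ≤ δ + C₁ ∫_{(s,t₁)} (t-σ)^{-(1/2+a)} n(σ)² dσ + C₂ ∫_{(t₁,t)} (t-σ)^{-1/2} n(σ) dσ`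
with `a < 1/2` and finite `C₂`. If `16 C₁ δ (T-s)^{1/2-a}/(1/2-a) ≤ 1`, then `n ≤ 4δ` a.e.
on `(s, T)`. Proof: induction over the windows `(s + kτ₀, s + (k+1)τ₀)`, `τ₀ = (4(C₂+1))⁻²`; on a
window the history term is `≤ 16 C₁ δ² (T-s)^{1/2-a}/(1/2-a) ≤ δ` by the induction hypothesis and
smallness, the local term is at most half the essential supremum `Y` of `n` on the window
(`C₂ · 2τ₀^{1/2} ≤ 1/2`), whence `Y ≤ 2δ + Y/2`, `Y ≤ 4δ`. [folklore] -/
theorem ae_le_four_mul_of_volterra_bootstrap {n : ℝ → ℝ≥0∞} {s T : ℝ} {δ Y₀ C₁ C₂ : ℝ≥0∞}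
    (hC₂ : C₂ ≠ ∞) {a : ℝ} (ha : a < 1 / 2) (hY₀ : Y₀ ≠ ∞)
    (hfin : ∀ᵐ t ∂(volume.restrict (Ioo s T)), n t ≤ Y₀)
    (hineq : ∀ᵐ t ∂(volume.restrict (Ioo s T)), ∀ t₁ ∈ Icc s t,
      n t ≤ δ + C₁ * (∫⁻ σ in Ioo s t₁, ENNReal.ofReal ((t - σ) ^ (-(1 / 2 + a))) * n σ ^ 2) +
        C₂ * ∫⁻ σ in Ioo t₁ t, ENNReal.ofReal ((t - σ) ^ (-(1 / 2 : ℝ))) * n σ)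
    (hsmall : 16 * C₁ * δ * ENNReal.ofReal ((T - s) ^ (1 / 2 - a) / (1 / 2 - a)) ≤ 1) :
    ∀ᵐ t ∂(volume.restrict (Ioo s T)), n t ≤ 4 * δ := by
  rcases le_or_gt T s with hTs | hsT
  · rw [Ioo_eq_empty_of_le hTs, Measure.restrict_empty, ae_zero]
    exact eventually_bot
  -- the step length `τ₀ = ρ²`, `ρ = (4 (C₂ + 1))⁻¹`
  set c₂ : ℝ := C₂.toReal with hc₂
  have hc₂0 : 0 ≤ c₂ := ENNReal.toReal_nonneg
  have hC₂eq : C₂ = ENNReal.ofReal c₂ := (ENNReal.ofReal_toReal hC₂).symm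
  set ρ : ℝ := 1 / (4 * (c₂ + 1)) with hρ
  have hρ0 : 0 < ρ := by positivity
  set τ₀ : ℝ := ρ ^ 2 with hτ₀
  have hτ₀0 : 0 < τ₀ := by positivity
  have hroot : τ₀ ^ (1 / 2 : ℝ) = ρ := by
    rw [hτ₀, ← Real.sqrt_eq_rpow, Real.sqrt_sq hρ0.le]
  have hhalf : C₂ * ENNReal.ofReal (τ₀ ^ (1 - 1 / 2 : ℝ) / (1 - 1 / 2)) ≤ 2⁻¹ := by
    rw [show (1 : ℝ) - 1 / 2 = 1 / 2 by norm_num, hroot, hC₂eq, ← ENNReal.ofReal_mul hc₂0,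
      show (2 : ℝ≥0∞)⁻¹ = ENNReal.ofReal (1 / 2) by
        rw [one_div, ENNReal.ofReal_inv_of_pos two_pos, ENNReal.ofReal_ofNat]]
    refine ENNReal.ofReal_le_ofReal ?_
    rw [hρ]
    have h1 : c₂ * (1 / (4 * (c₂ + 1)) / (1 / 2)) = (c₂ / (c₂ + 1)) / 2 := by
      field_simp
      ring
    rw [h1, div_le_iff₀ two_pos, div_le_iff₀ (by positivity)]
    linarith
  set X : ℝ≥0∞ := ENNReal.ofReal ((T - s) ^ (1 / 2 - a) / (1 / 2 - a)) with hX
  -- ### the induction over windows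
  have key : ∀ k : ℕ, ∀ᵐ t ∂(volume.restrict (Ioo s T)), t < s + k * τ₀ → n t ≤ 4 * δ := by
    intro k
    induction k with
    | zero =>
        filter_upwards [ae_restrict_mem measurableSet_Ioo] with t ht hlt
        simp only [Nat.cast_zero, zero_mul, add_zero] at hlt
        exact absurd hlt (not_lt.2 ht.1.le)
    | succ k ih =>
        set t₁ : ℝ := s + k * τ₀ with ht₁
        have hst₁ : s ≤ t₁ := by rw [ht₁]; exact le_add_of_nonneg_right (by positivity)
        have hsucc : s + ((k + 1 : ℕ) : ℝ) * τ₀ = t₁ + τ₀ := by push_cast; rw [ht₁]; ring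
        rcases le_or_gt T t₁ with hTt₁ | ht₁T
        · filter_upwards [ih, ae_restrict_mem measurableSet_Ioo] with t h ht _
          exact h (ht.2.trans_le hTt₁)
        -- the window `J = (t₁, min (t₁ + τ₀) T)`
        set T₂ : ℝ := min (t₁ + τ₀) T with hT₂
        set J : Set ℝ := Ioo t₁ T₂ with hJ
        have hJsub : J ⊆ Ioo s T := fun t ht =>
          ⟨hst₁.trans_lt ht.1, ht.2.trans_le (min_le_right _ _)⟩
        set Y : ℝ≥0∞ := essSup n (volume.restrict J) with hY
        have hYle : ∀ᵐ t ∂(volume.restrict J), n t ≤ Y := ENNReal.ae_le_essSup n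
        have hYfin : Y ≠ ∞ :=
          ne_top_of_le_ne_top hY₀ (essSup_le_of_ae_le Y₀
            (ae_restrict_of_ae_restrict_of_subset hJsub hfin))
        -- the induction hypothesis on `(s, t₁)`
        have ihJ : ∀ᵐ σ ∂(volume.restrict (Ioo s t₁)), n σ ≤ 4 * δ := by
          have h := ae_restrict_of_ae_restrict_of_subset (Ioo_subset_Ioo_right ht₁T.le) ih
          filter_upwards [h, ae_restrict_mem measurableSet_Ioo] with σ h hσ
          exact h hσ.2
        -- the main estimate on the window
        have hwin : ∀ᵐ t ∂(volume.restrict J), n t ≤ 2 * δ + Y / 2 := by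
          have h1 := ae_restrict_of_ae_restrict_of_subset hJsub hineq
          filter_upwards [h1, ae_restrict_mem measurableSet_Ioo] with t ht htJ
          have htt₁ : t₁ < t := htJ.1
          have htT : t < T := htJ.2.trans_le (min_le_right _ _)
          have htτ : t - t₁ ≤ τ₀ := by linarith [htJ.2.trans_le (min_le_left (t₁ + τ₀) T)]
          have h2 := ht t₁ ⟨hst₁, htt₁.le⟩
          -- the history term
          have hhist : C₁ * ∫⁻ σ in Ioo s t₁, ENNReal.ofReal ((t - σ) ^ (-(1 / 2 + a))) * n σ ^ 2
              ≤ δ := by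
            have hγ : 1 / 2 + a < 1 := by linarith
            calc C₁ * ∫⁻ σ in Ioo s t₁, ENNReal.ofReal ((t - σ) ^ (-(1 / 2 + a))) * n σ ^ 2
                ≤ C₁ * ∫⁻ σ in Ioo s t₁, ENNReal.ofReal ((t - σ) ^ (-(1 / 2 + a))) * (4 * δ) ^ 2 := by
                  gcongr C₁ * ?_
                  refine lintegral_mono_ae ?_
                  filter_upwards [ihJ] with σ hσ
                  gcongr
              _ = C₁ * ((∫⁻ σ in Ioo s t₁, ENNReal.ofReal ((t - σ) ^ (-(1 / 2 + a)))) * (4 * δ) ^ 2) := by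
                  rw [lintegral_mul_const _ (measurable_ofReal_rpow_sub_left t (1 / 2 + a))]
              _ ≤ C₁ * (X * (4 * δ) ^ 2) := by
                  gcongr
                  refine (lintegral_Ioo_ofReal_rpow_neg_sub_le hγ hst₁ htt₁.le).trans ?_
                  rw [hX, show (1 : ℝ) - (1 / 2 + a) = 1 / 2 - a by ring]
                  refine ENNReal.ofReal_le_ofReal (div_le_div_of_nonneg_right ?_ (by linarith))
                  exact Real.rpow_le_rpow (by linarith) (by linarith) (by linarith)
              _ = δ * (16 * C₁ * δ * X) := by ring
              _ ≤ δ * 1 := mul_le_mul' le_rfl hsmall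
              _ = δ := mul_one δ
          -- the local term
          have hloc : C₂ * ∫⁻ σ in Ioo t₁ t, ENNReal.ofReal ((t - σ) ^ (-(1 / 2 : ℝ))) * n σ
              ≤ Y / 2 := by
            have hYle' : ∀ᵐ σ ∂(volume.restrict (Ioo t₁ t)), n σ ≤ Y :=
              ae_restrict_of_ae_restrict_of_subset (Ioo_subset_Ioo_right htJ.2.le) hYle
            calc C₂ * ∫⁻ σ in Ioo t₁ t, ENNReal.ofReal ((t - σ) ^ (-(1 / 2 : ℝ))) * n σ
                ≤ C₂ * ∫⁻ σ in Ioo t₁ t, ENNReal.ofReal ((t - σ) ^ (-(1 / 2 : ℝ))) * Y := by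
                  gcongr C₂ * ?_
                  refine lintegral_mono_ae ?_
                  filter_upwards [hYle'] with σ hσ
                  gcongr
              _ = C₂ * ((∫⁻ σ in Ioo t₁ t, ENNReal.ofReal ((t - σ) ^ (-(1 / 2 : ℝ)))) * Y) := by
                  rw [lintegral_mul_const _ (measurable_ofReal_rpow_sub_left t (1 / 2))]
              _ ≤ C₂ * (ENNReal.ofReal (τ₀ ^ (1 - 1 / 2 : ℝ) / (1 - 1 / 2)) * Y) := by
                  gcongr
                  refine (lintegral_Ioo_ofReal_rpow_neg_sub_le (by norm_num : (1 / 2 : ℝ) < 1)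
                    htt₁.le le_rfl).trans ?_
                  refine ENNReal.ofReal_le_ofReal (div_le_div_of_nonneg_right ?_ (by norm_num))
                  exact Real.rpow_le_rpow (by linarith) htτ (by norm_num)
              _ = (C₂ * ENNReal.ofReal (τ₀ ^ (1 - 1 / 2 : ℝ) / (1 - 1 / 2))) * Y := (mul_assoc _ _ _).symm
              _ ≤ 2⁻¹ * Y := mul_le_mul' hhalf le_rfl
              _ = Y / 2 := by rw [ENNReal.div_eq_inv_mul]
          calc n t ≤ δ + C₁ * (∫⁻ σ in Ioo s t₁, ENNReal.ofReal ((t - σ) ^ (-(1 / 2 + a))) * n σ ^ 2) +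
                C₂ * ∫⁻ σ in Ioo t₁ t, ENNReal.ofReal ((t - σ) ^ (-(1 / 2 : ℝ))) * n σ := h2
            _ ≤ δ + δ + Y / 2 := add_le_add (add_le_add le_rfl hhist) hloc
            _ = 2 * δ + Y / 2 := by rw [two_mul]
        -- absorption
        have hY4 : Y ≤ 4 * δ := by
          have h1 : Y ≤ 2 * δ + Y / 2 := essSup_le_of_ae_le _ hwin
          calc Y ≤ 2 * (2 * δ) := ENNReal.le_two_mul_of_le_add_half hYfin h1
            _ = 4 * δ := by ring
        have hJbound : ∀ᵐ t ∂(volume.restrict (Ioo s T)), t ∈ J → n t ≤ 4 * δ := by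
          have h1 : ∀ᵐ t ∂(volume.restrict J), n t ≤ 4 * δ := by
            filter_upwards [hYle] with t ht using ht.trans hY4
          rw [ae_restrict_iff' measurableSet_Ioo] at h1
          exact ae_restrict_of_ae h1
        have hne : ∀ᵐ t ∂(volume.restrict (Ioo s T)), t ≠ t₁ := by
          refine ae_restrict_of_ae ?_
          have h := measure_eq_zero_iff_ae_notMem.1 (Real.volume_singleton (a := t₁))
          filter_upwards [h] with t ht
          simpa using ht
        filter_upwards [ih, hJbound, hne, ae_restrict_mem measurableSet_Ioo] with t h1 h2 h3 ht hlt
        rw [hsucc] at hlt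
        rcases lt_trichotomy t t₁ with h | h | h
        · exact h1 h
        · exact absurd h h3
        · exact h2 ⟨h, lt_min hlt ht.2⟩
  -- ### conclusion: finitely many windows cover `(s, T)`
  obtain ⟨k, hk⟩ := exists_nat_gt ((T - s) / τ₀)
  have hkT : T ≤ s + k * τ₀ := by
    have h1 : (T - s) / τ₀ * τ₀ = T - s := div_mul_cancel₀ _ hτ₀0.ne'
    nlinarith
  filter_upwards [key k, ae_restrict_mem measurableSet_Ioo] with t h ht
  exact h (ht.2.trans_le hkT)

end Bootstrap

/-! ### Selection of early times with a small weighted tail -/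

section Selection

/-- Reflection `σ ↦ -σ` in a set `lintegral` over `(-∞, -R)`. [folklore] -/
theorem lintegral_Iio_neg_comp_neg (g : ℝ → ℝ≥0∞) (R : ℝ) :
    ∫⁻ σ in Iio (-R), g (-σ) = ∫⁻ r in Ioi R, g r := by
  have A : MeasurableEmbedding fun x : ℝ => -x :=
    (Homeomorph.neg ℝ).isClosedEmbedding.measurableEmbedding
  have h := A.lintegral_map (μ := volume) ((Ioi R).indicator g)
  rw [Measure.map_neg_eq_self (volume : Measure ℝ), lintegral_indicator measurableSet_Ioi] at h
  rw [h, ← lintegral_indicator measurableSet_Iio]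
  congr 1
  funext σ
  simp only [indicator, mem_Ioi, mem_Iio]
  by_cases hσ : σ < -R
  · rw [if_pos hσ, if_pos (by linarith)]
  · rw [if_neg hσ, if_neg (by intro h'; exact hσ (by linarith))]

/-- `∫_{(R,∞)} dr / r = ∞` in `ℝ≥0∞`, `R > 0`. [folklore] -/
theorem lintegral_Ioi_ofReal_inv_eq_top {R : ℝ} (hR : 0 < R) :
    ∫⁻ r in Ioi R, ENNReal.ofReal (r ^ (-1 : ℝ)) = ∞ := by
  by_contra h
  have hni : ¬ IntegrableOn (fun r : ℝ => r ^ (-1 : ℝ)) (Ioi R) volume := by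
    rw [integrableOn_Ioi_rpow_iff hR]; norm_num
  refine hni ⟨?_, ?_⟩
  · exact ((measurable_id.pow_const _).aestronglyMeasurable).restrict
  · have hnn : 0 ≤ᵐ[volume.restrict (Ioi R)] fun r : ℝ => r ^ (-1 : ℝ) :=
      (ae_restrict_iff' measurableSet_Ioi).2 (Eventually.of_forall fun r hr =>
        Real.rpow_nonneg (hR.le.trans (le_of_lt hr)) _)
    exact (hasFiniteIntegral_iff_ofReal hnn).2 (lt_top_iff_ne_top.2 h)

/-- **Selection of good early times.** If `∫_{(-∞,0)} F < ∞` (`F ≥ 0` arbitrary), then for every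
`R > 0` and `ε > 0` the set `{σ < -R : F(σ) · |σ| < ε}` has positive Lebesgue measure: otherwise
`F(σ) ≥ ε/|σ|` for a.e. `σ < -R`, and `∫_{-∞}^{-R} ε/|σ| dσ = ∞`. (Applied to
`F(σ) = ‖u(σ)‖_{L^s}^l`: finiteness of the Ladyzhenskaya–Prodi–Serrin quantity yields arbitrarily
early times at which `|σ|^{1/l} ‖u(σ)‖_{L^s}` is as small as we please.) [folklore] -/
theorem measure_pos_setOf_mul_lt_of_lintegral_Iio_ne_top {F : ℝ → ℝ≥0∞}
    (hF : ∫⁻ σ in Iio (0 : ℝ), F σ ≠ ∞) {R : ℝ} (hR : 0 < R) {ε : ℝ≥0∞} (hε : 0 < ε) :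
    0 < volume {σ : ℝ | σ < -R ∧ F σ * ENNReal.ofReal (-σ) < ε} := by
  rw [pos_iff_ne_zero]
  intro h0
  have hae : ∀ᵐ σ : ℝ, σ ∉ {σ : ℝ | σ < -R ∧ F σ * ENNReal.ofReal (-σ) < ε} :=
    measure_eq_zero_iff_ae_notMem.1 h0
  -- below `-R`, `F ≥ ε |σ|⁻¹` a.e.
  have hlow : ∀ᵐ σ ∂(volume.restrict (Iio (-R))),
      ε * ENNReal.ofReal ((-σ) ^ (-1 : ℝ)) ≤ F σ := by
    refine (ae_restrict_iff' measurableSet_Iio).2 ?_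
    filter_upwards [hae] with σ hσ hlt
    have hσ0 : 0 < -σ := by linarith [mem_Iio.1 hlt]
    have hge : ε ≤ F σ * ENNReal.ofReal (-σ) := by
      by_contra h'
      exact hσ ⟨hlt, not_le.1 h'⟩
    have hinv : ENNReal.ofReal ((-σ) ^ (-1 : ℝ)) = (ENNReal.ofReal (-σ))⁻¹ := by
      rw [Real.rpow_neg_one, ENNReal.ofReal_inv_of_pos hσ0]
    rw [hinv, ← div_eq_mul_inv, ENNReal.div_le_iff_le_mul (Or.inl (ENNReal.ofReal_pos.2 hσ0).ne')
      (Or.inl ENNReal.ofReal_ne_top)]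
    exact hge
  have hdiv : ∫⁻ σ in Iio (-R), ε * ENNReal.ofReal ((-σ) ^ (-1 : ℝ)) = ∞ := by
    have h1 : ∫⁻ σ in Iio (-R), ENNReal.ofReal ((-σ) ^ (-1 : ℝ)) = ∞ := by
      have h := lintegral_Iio_neg_comp_neg (fun r => ENNReal.ofReal (r ^ (-1 : ℝ))) R
      rw [h]
      exact lintegral_Ioi_ofReal_inv_eq_top hR
    rw [lintegral_const_mul'' _ ((measurable_neg.pow_const _).ennreal_ofReal.aemeasurable), h1,
      ENNReal.mul_top hε.ne']
  refine hF (eq_top_iff.2 ?_)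
  calc (⊤ : ℝ≥0∞) = ∫⁻ σ in Iio (-R), ε * ENNReal.ofReal ((-σ) ^ (-1 : ℝ)) := hdiv.symm
    _ ≤ ∫⁻ σ in Iio (-R), F σ := lintegral_mono_ae hlow
    _ ≤ ∫⁻ σ in Iio (0 : ℝ), F σ := lintegral_mono_set (Iio_subset_Iio (by linarith))

end Selection

end Literature.Analysis.FluidPDE

end
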